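import Literature.Topology.FourManifolds.RailArches
import Literature.Topology.FourManifolds.BandRebuildCurve
import Literature.Topology.FourManifolds.CurveFamilyIsotopy
import HarnessLib

/-!
# Rebuilding a band sum with explicit arches, II: the rail loop and the rail knot

Topic `Literature/Topology/FourManifolds` (trunk T-4MAN). Fact seat
`provefact-Literature.Topology.FourManifolds.Knot.IsConnectedSum.isIsotopic` (Schubert's theorem).
Continuation of `RailArches.lean`: from `b : BandData A B K avoid` and the explicit rail arches
`railLo`, `railUp` we build

* `b.railPiece` — the piece function on the fundamental domain `[alo, alo + 1)`: `band (railLo t)`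
  on `[alo, tlo)`, `B (circlePt (psi t))` on `[tlo, thi)`, `band (railUp t)` on `[thi, ahi)`,
  `A (circlePt t)` on `[ahi, alo + 1)` (as `BandData.pieceFun` of `BandRebuildCurve.lean`, with the
  rail arches in place of the chosen ones); it is **globally `C^∞`** (`contDiff_railPiece`: the
  pieces overlap by the junction lemmas) and satisfies the **seam condition** at `alo`
  (`railPiece_seam`), it is unit and regular on the fundamental domain and injective there when the
  summands are disjoint (`injOn_railPiece`);
* `b.railLoop = periodise alo railPiece` — the `1`-periodic **rail loop**, a simple regular loop
  (`isRegularLoop_railLoop`; `CurveFamilyIsotopy.lean`);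
* `b.railKnot hAB : Knot` — the **rail knot** (`IsRegularLoop.toKnot`), with
  `coe_railKnot_circlePt` and `image_coe_range_railKnot`.

This is the knot on which the proof of the geometric heart of Schubert's theorem operates: it is a
band sum of `A` and `B` along the band of `b` (sequel), and inside the band it consists of the two
*rails* at heights `1/4` and `3/4` with short explicit connections to the edges.

## References

Standard; all statements `[folklore]` (band sums: R. E. Gompf, A. I. Stipsicz, *4-Manifolds and
Kirby Calculus* (1999), §5.1).
-/

open scoped Manifold ContDiff Topology Real
open Function Set Metric Filter

noncomputable section

namespace Literature.Topology.FourManifolds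

/-- Local notation: `𝔼 n` is the model Euclidean space `EuclideanSpace ℝ (Fin n)`. -/
local notation "𝔼 " n:arg => EuclideanSpace ℝ (Fin n)

/-- Local notation: `𝕊 n` is the unit sphere in `EuclideanSpace ℝ (Fin (n + 1))`. -/
local notation "𝕊 " n:arg => (Metric.sphere (0 : EuclideanSpace ℝ (Fin (n + 1))) 1)

namespace BandData

variable {A B K : Knot} {avoid : Set (𝕊 3)} (b : BandData A B K avoid)

/-! ### The piece function -/

/-- The rail piece function on the fundamental domain `[alo, alo + 1)`: lower rail arch, `B`,
upper rail arch, `A`. [folklore] -/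
def railPiece (t : ℝ) : 𝔼 4 :=
  if t < b.tlo then ((b.band (b.railLo t) : 𝕊 3) : 𝔼 4)
  else if t < b.thi then Knot.curve B (b.psi t)
  else if t < b.ahi then ((b.band (b.railUp t) : 𝕊 3) : 𝔼 4)
  else Knot.curve A t

/-- **The rail loop**: the periodisation of the rail piece function. [folklore] -/
def railLoop : ℝ → 𝔼 4 := periodise b.alo b.railPiece

/-- The rail loop is `1`-periodic. [folklore] -/
theorem periodic_railLoop : Periodic b.railLoop 1 := periodic_periodise _ _

/-- On the fundamental domain the rail loop is the piece function. [folklore] -/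
theorem railLoop_eq_railPiece {t : ℝ} (ht : t ∈ Ico b.alo (b.alo + 1)) : b.railLoop t = b.railPiece t :=
  periodise_eq_self _ _ ht

/-- Values of the four pieces. [folklore] -/
theorem railPiece_of_lt_tlo {t : ℝ} (ht : t < b.tlo) : b.railPiece t = ((b.band (b.railLo t) : 𝕊 3) : 𝔼 4) := by
  simp [railPiece, ht]

/-- Values of the four pieces. [folklore] -/
theorem railPiece_of_tlo_le {t : ℝ} (h1 : b.tlo ≤ t) (h2 : t < b.thi) :
    b.railPiece t = Knot.curve B (b.psi t) := by
  simp [railPiece, not_lt.2 h1, h2]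

/-- Values of the four pieces. [folklore] -/
theorem railPiece_of_thi_le {t : ℝ} (h1 : b.thi ≤ t) (h2 : t < b.ahi) :
    b.railPiece t = ((b.band (b.railUp t) : 𝕊 3) : 𝔼 4) := by
  have h0 : ¬ t < b.tlo := not_lt.2 (b.marks_lt.2.2.2.1.le.trans h1)
  simp [railPiece, h0, not_lt.2 h1, h2]

/-- Values of the four pieces. [folklore] -/
theorem railPiece_of_ahi_le {t : ℝ} (h1 : b.ahi ≤ t) : b.railPiece t = Knot.curve A t := by
  have hm := b.marks_lt
  have h0 : ¬ t < b.tlo := not_lt.2 (by linarith)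
  have h0' : ¬ t < b.thi := not_lt.2 (by linarith)
  simp [railPiece, h0, h0', not_lt.2 h1]

/-- The rail piece function lies on the unit sphere. [folklore] -/
theorem norm_railPiece (t : ℝ) : ‖b.railPiece t‖ = 1 := by
  rw [railPiece]
  split_ifs
  · exact norm_eq_of_mem_sphere _
  · exact Knot.norm_curve B _
  · exact norm_eq_of_mem_sphere _
  · exact Knot.norm_curve A _

/-! ### Local representations -/
/-- The junction at `tlo` extended: on `(tlo - epsLo, thi)` the piece function is
`B ∘ circlePt ∘ psi`. [folklore] -/
theorem railPiece_eq_B {t : ℝ} (ht : t ∈ Ioo (b.tlo - b.epsLo) b.thi) :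
    b.railPiece t = Knot.curve B (b.psi t) := by
  rcases lt_or_ge t b.tlo with h | h
  · rw [b.railPiece_of_lt_tlo h, Knot.curve_apply, b.band_railLo_eq_B ⟨ht.1.le, ?_⟩]
    exact h.le.trans b.tlo_marksB.1.le
  · exact b.railPiece_of_tlo_le h ht.2

/-- The junction at `thi` extended: on `[tlo, thi + epsHi)` the piece function is
`B ∘ circlePt ∘ psi`. [folklore] -/
theorem railPiece_eq_B' {t : ℝ} (ht : t ∈ Ico b.tlo (b.thi + b.epsHi)) :
    b.railPiece t = Knot.curve B (b.psi t) := by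
  have hm := b.marks_lt
  obtain ⟨hε, hε1, -⟩ := b.epsHi_bounds
  rcases lt_or_ge t b.thi with h | h
  · exact b.railPiece_of_tlo_le ht.1 h
  · rw [b.railPiece_of_thi_le h (by linarith [ht.2]), Knot.curve_apply,
      b.band_railUp_eq_B ⟨?_, ht.2.le⟩]
    exact (b.thi_marksB.1.le).trans h

/-- The junction at `ahi` extended: on `[thi + epsHi, ∞) ∩ (ahi - epsHi, ∞)`... precisely on
`(ahi - epsHi, alo + 1)` the piece function is `A ∘ circlePt`. [folklore] -/
theorem railPiece_eq_A {t : ℝ} (ht : t ∈ Ioo (b.ahi - b.epsHi) (b.alo + 1)) :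
    b.railPiece t = Knot.curve A t := by
  have hm := b.marks_lt
  obtain ⟨hε, hε1, -⟩ := b.epsHi_bounds
  rcases lt_or_ge t b.ahi with h | h
  · rw [b.railPiece_of_thi_le (by linarith [ht.1]) h, Knot.curve_apply, b.band_railUp_eq_A ⟨ht.1.le, ?_⟩]
    linarith
  · exact b.railPiece_of_ahi_le h

/-- The junction at `alo` (wrap point): on `[alo, alo + epsLo)` the piece function is
`A ∘ circlePt`. [folklore] -/
theorem railPiece_eq_A' {t : ℝ} (ht : t ∈ Ico b.alo (b.alo + b.epsLo)) :
    b.railPiece t = Knot.curve A t := by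
  have hm := b.marks_lt
  obtain ⟨hε, hε1, -⟩ := b.epsLo_bounds
  rw [b.railPiece_of_lt_tlo (by linarith [ht.2]), Knot.curve_apply, b.band_railLo_eq_A ⟨by linarith [ht.1], ht.2.le⟩]

/-- **The rail piece function is `C^∞` on the whole line** (the four pieces overlap on open sets by
the junction lemmas). [folklore] -/
theorem contDiff_railPiece : ContDiff ℝ ∞ b.railPiece := by
  have hm := b.marks_lt
  obtain ⟨hε, hε1, -⟩ := b.epsLo_bounds
  obtain ⟨hε', hε1', -⟩ := b.epsHi_bounds
  have hLo : ContDiff ℝ ∞ fun t ↦ ((b.band (b.railLo t) : 𝕊 3) : 𝔼 4) := b.contDiff_coe_band.comp b.contDiff_railLo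
  have hUp : ContDiff ℝ ∞ fun t ↦ ((b.band (b.railUp t) : 𝕊 3) : 𝔼 4) := b.contDiff_coe_band.comp b.contDiff_railUp
  have hBp : ContDiff ℝ ∞ fun t ↦ Knot.curve B (b.psi t) := (Knot.contDiff_curve B).comp b.contDiff_psi
  have hAp : ContDiff ℝ ∞ (Knot.curve A) := Knot.contDiff_curve A
  rw [contDiff_iff_contDiffAt]
  intro t
  rcases lt_or_ge t b.tlo with h1 | h1
  · refine hLo.contDiffAt.congr_of_eventuallyEq ?_
    filter_upwards [Iio_mem_nhds h1] with s hs using b.railPiece_of_lt_tlo hs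
  rcases lt_or_ge t (b.thi + b.epsHi) with h2 | h2
  · refine hBp.contDiffAt.congr_of_eventuallyEq ?_
    filter_upwards [isOpen_Ioo.mem_nhds (show t ∈ Ioo (b.tlo - b.epsLo) (b.thi + b.epsHi) from
      ⟨by linarith, h2⟩)] with s hs
    rcases lt_or_ge s b.tlo with h | h
    · exact b.railPiece_eq_B ⟨hs.1, by linarith⟩
    · exact b.railPiece_eq_B' ⟨h, hs.2⟩
  rcases lt_or_ge t b.ahi with h3 | h3
  · refine hUp.contDiffAt.congr_of_eventuallyEq ?_
    filter_upwards [isOpen_Ioo.mem_nhds (show t ∈ Ioo b.thi b.ahi from ⟨by linarith, h3⟩)] with s hs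
    exact b.railPiece_of_thi_le hs.1.le hs.2
  · refine hAp.contDiffAt.congr_of_eventuallyEq ?_
    filter_upwards [Ioi_mem_nhds (show b.ahi - b.epsHi < t by linarith)] with s hs
    rcases lt_or_ge s (b.alo + 1) with h | h
    · exact b.railPiece_eq_A ⟨hs, h⟩
    · exact b.railPiece_of_ahi_le (by linarith)

/-- The seam margin at `alo`. [folklore] -/
def seamEps : ℝ := min b.epsLo (min (b.alo - b.thetaA (3 / 20)) (b.alo + 1 - b.ahi)) / 2

/-- The seam margin is positive and small. [folklore] -/
theorem seamEps_bounds : 0 < b.seamEps ∧ b.seamEps < b.epsLo ∧ b.seamEps < b.alo - b.thetaA (3 / 20) ∧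
    b.seamEps < b.alo + 1 - b.ahi := by
  have hm := b.marks_lt
  obtain ⟨hε, -, -⟩ := b.epsLo_bounds
  have h1 : b.thetaA (3 / 20) < b.alo := hm.2.1
  have h2 : b.ahi < b.alo + 1 := by linarith [hm.1, hm.2.1, hm.2.2.2.2.2.1, hm.2.2.2.2.2.2.1, hm.2.2.2.2.2.2.2]
  have hpos : 0 < min b.epsLo (min (b.alo - b.thetaA (3 / 20)) (b.alo + 1 - b.ahi)) :=
    lt_min hε (lt_min (by linarith) (by linarith))
  refine ⟨by rw [seamEps]; positivity, ?_, ?_, ?_⟩ <;> rw [seamEps]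
  · linarith [min_le_left b.epsLo (min (b.alo - b.thetaA (3 / 20)) (b.alo + 1 - b.ahi))]
  · linarith [min_le_right b.epsLo (min (b.alo - b.thetaA (3 / 20)) (b.alo + 1 - b.ahi)),
      min_le_left (b.alo - b.thetaA (3 / 20)) (b.alo + 1 - b.ahi)]
  · linarith [min_le_right b.epsLo (min (b.alo - b.thetaA (3 / 20)) (b.alo + 1 - b.ahi)),
      min_le_right (b.alo - b.thetaA (3 / 20)) (b.alo + 1 - b.ahi)]

/-- **The seam condition**: near `alo` the piece function is `A` on both sides,
`railPiece (t + 1) = railPiece t`. [folklore] -/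
theorem railPiece_seam : ∀ t ∈ Ioo (b.alo - b.seamEps) (b.alo + b.seamEps), b.railPiece (t + 1) = b.railPiece t := by
  obtain ⟨h0, h1, h2, h3⟩ := b.seamEps_bounds
  have hm := b.marks_lt
  obtain ⟨hε, hε1, -⟩ := b.epsLo_bounds
  intro t ht
  rw [b.railPiece_of_ahi_le (by linarith [ht.1]), b.railPiece_of_lt_tlo (by linarith [ht.2]),
    Knot.curve_apply, b.band_railLo_eq_A ⟨by linarith [ht.1], by linarith [ht.2]⟩]
  exact congrArg (fun p : 𝕊 3 ↦ (p : 𝔼 4)) (by rw [circlePt_add_one])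

/-- **The rail loop is `C^∞`.** [folklore] -/
theorem contDiff_railLoop : ContDiff ℝ ∞ b.railLoop :=
  contDiff_periodise b.contDiff_railPiece b.seamEps_bounds.1 b.railPiece_seam

/-- The rail loop is continuous. [folklore] -/
theorem continuous_railLoop : Continuous b.railLoop := b.contDiff_railLoop.continuous

/-- **The rail piece function is regular on the fundamental domain.** [folklore] -/
theorem deriv_railPiece_ne_zero {t : ℝ} (ht : t ∈ Ico b.alo (b.alo + 1)) : deriv b.railPiece t ≠ 0 := by
  have hm := b.marks_lt
  obtain ⟨hε, hε1, -⟩ := b.epsLo_bounds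
  obtain ⟨hε', hε1', -⟩ := b.epsHi_bounds
  rcases lt_or_ge t b.tlo with h1 | h1
  · have hev : b.railPiece =ᶠ[𝓝 t] fun s ↦ ((b.band (b.railLo s) : 𝕊 3) : 𝔼 4) := by
      filter_upwards [Iio_mem_nhds h1] with s hs using b.railPiece_of_lt_tlo hs
    rw [hev.deriv_eq]
    exact b.deriv_coe_band_comp_ne_zero ((b.contDiff_railLo.differentiable (by simp)) _)
      (b.railLo_mem ⟨ht.1, h1.le⟩).1 (b.deriv_railLo_ne_zero _)
  rcases le_or_gt t b.thi with h2 | h2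
  · have hev : b.railPiece =ᶠ[𝓝 t] fun s ↦ Knot.curve B (b.psi s) := by
      filter_upwards [isOpen_Ioo.mem_nhds (show t ∈ Ioo (b.tlo - b.epsLo) (b.thi + b.epsHi) from
        ⟨by linarith, by linarith⟩)] with s hs
      rcases lt_or_ge s b.tlo with h | h
      · exact b.railPiece_eq_B ⟨hs.1, by linarith⟩
      · exact b.railPiece_eq_B' ⟨h, hs.2⟩
    rw [hev.deriv_eq]
    have hd : HasDerivAt (fun s ↦ Knot.curve B (b.psi s)) (b.lam • deriv (Knot.curve B) (b.psi t)) t :=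
      (((Knot.contDiff_curve B).differentiable (by simp)) (b.psi t)).hasDerivAt.scomp t (b.hasDerivAt_psi t)
    rw [hd.deriv]
    exact smul_ne_zero b.lam_pos.ne' (Knot.deriv_curve_ne_zero B _)
  rcases lt_or_ge t b.ahi with h3 | h3
  · have hev : b.railPiece =ᶠ[𝓝 t] fun s ↦ ((b.band (b.railUp s) : 𝕊 3) : 𝔼 4) := by
      filter_upwards [isOpen_Ioo.mem_nhds (show t ∈ Ioo b.thi b.ahi from ⟨h2, h3⟩)] with s hs
      exact b.railPiece_of_thi_le hs.1.le hs.2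
    rw [hev.deriv_eq]
    exact b.deriv_coe_band_comp_ne_zero ((b.contDiff_railUp.differentiable (by simp)) _)
      (b.railUp_mem ⟨h2.le, h3.le⟩).1 (b.deriv_railUp_ne_zero _)
  · have hev : b.railPiece =ᶠ[𝓝 t] Knot.curve A := by
      filter_upwards [Ioi_mem_nhds (show b.ahi - b.epsHi < t by linarith)] with s hs
      rcases lt_or_ge s (b.alo + 1) with h | h
      · exact b.railPiece_eq_A ⟨hs, h⟩
      · exact b.railPiece_of_ahi_le (by linarith)
    rw [hev.deriv_eq]
    exact Knot.deriv_curve_ne_zero A _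

/-- **The rail loop is a regular loop of period one.** [folklore] -/
theorem isRegularLoop_railLoop : IsRegularLoop b.railLoop :=
  isRegularLoop_periodise b.contDiff_railPiece b.seamEps_bounds.1 b.railPiece_seam
    (fun t _ ↦ b.norm_railPiece t) (fun _ ht ↦ b.deriv_railPiece_ne_zero ht)

/-! ### Injectivity on the fundamental domain -/
/-- **Type A**: on `[alo, alo + epsLo]` and on `[ahi - epsHi, alo + 1)` the piece function is the
summand `A`. [folklore] -/
theorem railPiece_typeA {s : ℝ} (hs : s ∈ Ico b.alo (b.alo + 1))
    (h : s ≤ b.alo + b.epsLo ∨ b.ahi - b.epsHi ≤ s) : b.railPiece s = Knot.curve A s := by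
  have hm := b.marks_lt
  obtain ⟨hε, hε1, -⟩ := b.epsLo_bounds
  obtain ⟨hε', hε1', -⟩ := b.epsHi_bounds
  rcases h with h | h
  · rw [b.railPiece_of_lt_tlo (by linarith), Knot.curve_apply, b.band_railLo_eq_A ⟨by linarith [hs.1], h⟩]
  · rcases lt_or_ge s b.ahi with h' | h'
    · rw [b.railPiece_of_thi_le (by linarith) h', Knot.curve_apply, b.band_railUp_eq_A ⟨h, by linarith⟩]
    · exact b.railPiece_of_ahi_le h'

/-- **Type B**: on `[tlo - epsLo, thi + epsHi]` the piece function is the summand `B` at the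
parameter `psi s`. [folklore] -/
theorem railPiece_typeB {s : ℝ} (h : s ∈ Icc (b.tlo - b.epsLo) (b.thi + b.epsHi)) :
    b.railPiece s = Knot.curve B (b.psi s) := by
  have hm := b.marks_lt
  obtain ⟨hε', hε1', -⟩ := b.epsHi_bounds
  rcases lt_or_ge s b.tlo with h1 | h1
  · rw [b.railPiece_of_lt_tlo h1, Knot.curve_apply, b.band_railLo_eq_B ⟨h.1, h1.le.trans b.tlo_marksB.1.le⟩]
  rcases lt_or_ge s b.thi with h2 | h2
  · exact b.railPiece_of_tlo_le h1 h2
  · rw [b.railPiece_of_thi_le h2 (by linarith [h.2]), Knot.curve_apply,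
      b.band_railUp_eq_B ⟨b.thi_marksB.1.le.trans h2, h.2⟩]

/-- **Type O (lower arch)**: on `(alo + epsLo, tlo - epsLo)` the piece function is a band point
strictly inside the square, below height `2/5`, off both summands. [folklore] -/
theorem railPiece_typeO_lo {s : ℝ} (h : s ∈ Ioo (b.alo + b.epsLo) (b.tlo - b.epsLo)) :
    b.railPiece s = ((b.band (b.railLo s) : 𝕊 3) : 𝔼 4) ∧ b.railLo s ∈ squareNhd b.δ ∧
      b.railLo s 0 ∈ Ioo (0 : ℝ) 1 ∧ b.railLo s 1 < 2 / 5 ∧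
      b.band (b.railLo s) ∉ range A ∧ b.band (b.railLo s) ∉ range B := by
  obtain ⟨hε, hε1, -⟩ := b.epsLo_bounds
  obtain ⟨hU, h1⟩ := b.railLo_mem (t := s) ⟨by linarith [h.1], by linarith [h.2]⟩
  have h0 := b.railLo_zero_mem_Ioo h
  exact ⟨b.railPiece_of_lt_tlo (by linarith [h.2]), hU, h0, h1.2,
    b.band_not_mem_range_A hU h0.1.ne', b.band_not_mem_range_B hU h0.2.ne⟩

/-- **Type O (upper arch)**: on `(thi + epsHi, ahi - epsHi)` the piece function is a band point
strictly inside the square, above height `3/5`, off both summands. [folklore] -/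
theorem railPiece_typeO_hi {s : ℝ} (h : s ∈ Ioo (b.thi + b.epsHi) (b.ahi - b.epsHi)) :
    b.railPiece s = ((b.band (b.railUp s) : 𝕊 3) : 𝔼 4) ∧ b.railUp s ∈ squareNhd b.δ ∧
      b.railUp s 0 ∈ Ioo (0 : ℝ) 1 ∧ 3 / 5 < b.railUp s 1 ∧
      b.band (b.railUp s) ∉ range A ∧ b.band (b.railUp s) ∉ range B := by
  obtain ⟨hε, hε1, -⟩ := b.epsHi_bounds
  obtain ⟨hU, h1⟩ := b.railUp_mem (t := s) ⟨by linarith [h.1], by linarith [h.2]⟩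
  have h0 := b.railUp_zero_mem_Ioo h
  exact ⟨b.railPiece_of_thi_le (by linarith [h.1]) (by linarith [h.2]), hU, h0, h1.1,
    b.band_not_mem_range_A hU h0.1.ne', b.band_not_mem_range_B hU h0.2.ne⟩

/-- **The rail piece function is injective on the fundamental domain** when the summands are
disjoint.
[folklore] -/
theorem injOn_railPiece (hAB : Disjoint (range A) (range B)) : InjOn b.railPiece (Ico b.alo (b.alo + 1)) := by
  have hAB' : ∀ s t, Knot.curve A s ≠ Knot.curve B t := fun s t h ↦ by
    rw [Knot.curve_apply, Knot.curve_apply] at h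
    exact Set.disjoint_left.1 hAB ⟨circlePt s, rfl⟩ ⟨circlePt t, (Subtype.ext h).symm⟩
  intro s hs t ht hst
  rcases b.kind_cases s with hks | hks | hks | hks <;> rcases b.kind_cases t with hkt | hkt | hkt | hkt
  -- A / A
  · rw [b.railPiece_typeA hs hks, b.railPiece_typeA ht hkt] at hst
    exact b.eq_of_curve_A_eq hs ht hst
  -- A / B
  · rw [b.railPiece_typeA hs hks, b.railPiece_typeB hkt] at hst
    exact absurd hst (hAB' _ _)
  -- A / O
  · obtain ⟨he, hU, h0, -, hnA, -⟩ := b.railPiece_typeO_lo hkt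
    rw [b.railPiece_typeA hs hks, he, Knot.curve_apply] at hst
    exact absurd ⟨_, Subtype.ext hst⟩ hnA
  · obtain ⟨he, hU, h0, -, hnA, -⟩ := b.railPiece_typeO_hi hkt
    rw [b.railPiece_typeA hs hks, he, Knot.curve_apply] at hst
    exact absurd ⟨_, Subtype.ext hst⟩ hnA
  -- B / A
  · rw [b.railPiece_typeB hks, b.railPiece_typeA ht hkt] at hst
    exact absurd hst.symm (hAB' _ _)
  -- B / B
  · rw [b.railPiece_typeB hks, b.railPiece_typeB hkt] at hst
    exact b.eq_of_curve_B_psi_eq hks hkt hst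
  -- B / O
  · obtain ⟨he, hU, h0, -, -, hnB⟩ := b.railPiece_typeO_lo hkt
    rw [b.railPiece_typeB hks, he, Knot.curve_apply] at hst
    exact absurd ⟨_, Subtype.ext hst⟩ hnB
  · obtain ⟨he, hU, h0, -, -, hnB⟩ := b.railPiece_typeO_hi hkt
    rw [b.railPiece_typeB hks, he, Knot.curve_apply] at hst
    exact absurd ⟨_, Subtype.ext hst⟩ hnB
  -- O_lo / A, B
  · obtain ⟨he, hU, h0, -, hnA, -⟩ := b.railPiece_typeO_lo hks
    rw [b.railPiece_typeA ht hkt, he, Knot.curve_apply] at hst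
    exact absurd ⟨_, Subtype.ext hst.symm⟩ hnA
  · obtain ⟨he, hU, h0, -, -, hnB⟩ := b.railPiece_typeO_lo hks
    rw [b.railPiece_typeB hkt, he, Knot.curve_apply] at hst
    exact absurd ⟨_, Subtype.ext hst.symm⟩ hnB
  -- O_lo / O_lo
  · obtain ⟨he, hU, -, -, -, -⟩ := b.railPiece_typeO_lo hks
    obtain ⟨he', hU', -, -, -, -⟩ := b.railPiece_typeO_lo hkt
    rw [he, he'] at hst
    exact b.injective_railLo (b.injOn hU hU' (Subtype.ext hst))
  -- O_lo / O_hi : heights differ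
  · obtain ⟨he, hU, -, h1, -, -⟩ := b.railPiece_typeO_lo hks
    obtain ⟨he', hU', -, h1', -, -⟩ := b.railPiece_typeO_hi hkt
    rw [he, he'] at hst
    have := congrArg (fun x : 𝔼 2 ↦ x 1) (b.injOn hU hU' (Subtype.ext hst))
    simp only at this
    linarith
  -- O_hi / A, B
  · obtain ⟨he, hU, h0, -, hnA, -⟩ := b.railPiece_typeO_hi hks
    rw [b.railPiece_typeA ht hkt, he, Knot.curve_apply] at hst
    exact absurd ⟨_, Subtype.ext hst.symm⟩ hnA
  · obtain ⟨he, hU, h0, -, -, hnB⟩ := b.railPiece_typeO_hi hks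
    rw [b.railPiece_typeB hkt, he, Knot.curve_apply] at hst
    exact absurd ⟨_, Subtype.ext hst.symm⟩ hnB
  -- O_hi / O_lo
  · obtain ⟨he, hU, -, h1, -, -⟩ := b.railPiece_typeO_hi hks
    obtain ⟨he', hU', -, h1', -, -⟩ := b.railPiece_typeO_lo hkt
    rw [he, he'] at hst
    have := congrArg (fun x : 𝔼 2 ↦ x 1) (b.injOn hU hU' (Subtype.ext hst))
    simp only at this
    linarith
  -- O_hi / O_hi
  · obtain ⟨he, hU, -, -, -, -⟩ := b.railPiece_typeO_hi hks
    obtain ⟨he', hU', -, -, -, -⟩ := b.railPiece_typeO_hi hkt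
    rw [he, he'] at hst
    exact b.injective_railUp (b.injOn hU hU' (Subtype.ext hst))

/-! ### The rail knot -/

/-- **The rail knot** of a band-sum presentation with disjoint summands: the knot of the simple
regular rail loop (`IsRegularLoop.toKnot`). [folklore] -/
def railKnot (hAB : Disjoint (range A) (range B)) : Knot :=
  b.isRegularLoop_railLoop.toKnot (periodise_simple_iff.2 (b.injOn_railPiece hAB))

/-- The rail knot through the parameter `circlePt t` is `railLoop t` in `ℝ⁴`. [folklore] -/
theorem coe_railKnot_circlePt (hAB : Disjoint (range A) (range B)) (t : ℝ) :
    ((b.railKnot hAB (circlePt t) : 𝕊 3) : 𝔼 4) = b.railLoop t :=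
  b.isRegularLoop_railLoop.coe_toKnot_circlePt _ t

/-- The range of the rail knot, read in `ℝ⁴`, is the image of the fundamental domain under the
piece function. [folklore] -/
theorem image_coe_range_railKnot (hAB : Disjoint (range A) (range B)) :
    (Subtype.val : (𝕊 3) → 𝔼 4) '' range (b.railKnot hAB) = b.railPiece '' Ico b.alo (b.alo + 1) := by
  rw [railKnot, IsRegularLoop.image_coe_range_toKnot]
  ext p
  simp only [mem_range, mem_image]
  constructor
  · rintro ⟨t, rfl⟩
    exact ⟨toIcoMod zero_lt_one b.alo t, toIcoMod_one_mem b.alo t, rfl⟩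
  · rintro ⟨s, hs, rfl⟩
    exact ⟨s, b.railLoop_eq_railPiece hs⟩

/-- A point of the rail knot is a value of the piece function on the fundamental domain.
[folklore] -/
theorem mem_range_railKnot_iff (hAB : Disjoint (range A) (range B)) {p : 𝕊 3} :
    p ∈ range (b.railKnot hAB) ↔ ∃ s ∈ Ico b.alo (b.alo + 1), b.railPiece s = (p : 𝔼 4) := by
  constructor
  · intro hp
    have : (p : 𝔼 4) ∈ (Subtype.val : (𝕊 3) → 𝔼 4) '' range (b.railKnot hAB) := ⟨p, hp, rfl⟩
    rw [b.image_coe_range_railKnot hAB] at this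
    obtain ⟨s, hs, he⟩ := this
    exact ⟨s, hs, he⟩
  · rintro ⟨s, hs, he⟩
    have : (p : 𝔼 4) ∈ b.railPiece '' Ico b.alo (b.alo + 1) := ⟨s, hs, he⟩
    rw [← b.image_coe_range_railKnot hAB] at this
    obtain ⟨q, hq, hqp⟩ := this
    rwa [← Subtype.ext hqp]

/-! ### The standard arcs of the rail presentation -/

/-- **The lower arc** of the rail presentation. [folklore] -/
def railLoArc (u : ℝ) : 𝔼 2 := b.railLo (b.rhoLo u)

/-- **The upper arc** of the rail presentation. [folklore] -/
def railUpArc (u : ℝ) : 𝔼 2 := b.railUp (b.rhoUp u)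

/-- The lower arc is `C^∞`. [folklore] -/
theorem contDiff_railLoArc : ContDiff ℝ ∞ b.railLoArc := b.contDiff_railLo.comp b.rhoLo_spec.1

/-- The upper arc is `C^∞`. [folklore] -/
theorem contDiff_railUpArc : ContDiff ℝ ∞ b.railUpArc := b.contDiff_railUp.comp b.rhoUp_spec.1

/-- The lower arc is injective. [folklore] -/
theorem injective_railLoArc : Injective b.railLoArc :=
  b.injective_railLo.comp b.rhoLo_spec.2.2.2.2.2.injective

/-- The upper arc is injective. [folklore] -/
theorem injective_railUpArc : Injective b.railUpArc :=
  b.injective_railUp.comp b.rhoUp_spec.2.2.2.2.2.injective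

/-- The lower arc is regular. [folklore] -/
theorem deriv_railLoArc_ne_zero (u : ℝ) : deriv b.railLoArc u ≠ 0 := by
  rw [show b.railLoArc = fun u ↦ b.railLo (b.rhoLo u) from rfl, deriv_comp_reparam b.contDiff_railLo b.rhoLo_spec.1]
  exact smul_ne_zero (b.rhoLo_spec.2.2.2.2.1 u).ne' (b.deriv_railLo_ne_zero _)

/-- The upper arc is regular. [folklore] -/
theorem deriv_railUpArc_ne_zero (u : ℝ) : deriv b.railUpArc u ≠ 0 := by
  rw [show b.railUpArc = fun u ↦ b.railUp (b.rhoUp u) from rfl, deriv_comp_reparam b.contDiff_railUp b.rhoUp_spec.1]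
  exact smul_ne_zero (b.rhoUp_spec.2.2.2.2.1 u).ne' (b.deriv_railUp_ne_zero _)

/-- The lower arc starts at the lower-left corner `(0, -δ)`. [folklore] -/
theorem railLoArc_zero : b.railLoArc 0 = pt2 0 (-b.δ) := by
  have h := b.lo_order
  obtain ⟨hε, -, -⟩ := b.epsLo_bounds
  rw [railLoArc, b.rhoLo_spec.2.1, b.railLo_eq_left (by linarith), b.tstarLo_spec.2]

/-- The lower arc ends at the lower-right corner `(1, -δ)`. [folklore] -/
theorem railLoArc_one : b.railLoArc 1 = pt2 1 (-b.δ) := by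
  have h := b.lo_order
  obtain ⟨hε, -, -⟩ := b.epsLo_bounds
  rw [railLoArc, b.rhoLo_spec.2.2.2.1, b.railLo_eq_right (by linarith), b.tendLo_spec.2]

/-- The upper arc starts at the upper-right corner `(1, 1 + δ)`. [folklore] -/
theorem railUpArc_zero : b.railUpArc 0 = pt2 1 (1 + b.δ) := by
  have h := b.up_order
  obtain ⟨hε, -, -⟩ := b.epsHi_bounds
  rw [railUpArc, b.rhoUp_spec.2.1, b.railUp_eq_right (by linarith), b.tstarUp_spec.2]

/-- The upper arc ends at the upper-left corner `(0, 1 + δ)`. [folklore] -/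
theorem railUpArc_one : b.railUpArc 1 = pt2 0 (1 + b.δ) := by
  have h := b.up_order
  obtain ⟨hε, -, -⟩ := b.epsHi_bounds
  rw [railUpArc, b.rhoUp_spec.2.2.2.1, b.railUp_eq_left (by linarith), b.tendUp_spec.2]

/-- The midpoint of the lower arc. [folklore] -/
theorem railLoArc_half : b.railLoArc 2⁻¹ = b.railLo ((b.alo + b.tlo) / 2) := by rw [railLoArc, b.rhoLo_spec.2.2.1]

/-- The midpoint of the upper arc. [folklore] -/
theorem railUpArc_half : b.railUpArc 2⁻¹ = b.railUp ((b.thi + b.ahi) / 2) := by rw [railUpArc, b.rhoUp_spec.2.2.1]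

/-! ### Heights along the arches over their whole stretch -/

/-- **The lower arc lies in the lower half of the square neighbourhood** (away from its
endpoints): heights in `(-δ, 2/5)`. [folklore] -/
theorem railLo_mem_of_mem_Ioo {t : ℝ} (ht : t ∈ Ioo b.tstarLo b.tendLo) :
    b.railLo t ∈ squareNhd b.δ ∧ b.railLo t 1 ∈ Ioo (-b.δ) (2 / 5) := by
  have hm := b.marks_lt
  have hδ := b.δ_pos
  obtain ⟨hε, hε1, -⟩ := b.epsLo_bounds
  have ho := b.lo_order
  have hx0 := b.railLo_zero_mem_Icc t
  -- heights
  have hx1 : b.railLo t 1 ∈ Ioo (-b.δ) (2 / 5) := by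
    rcases le_or_gt t (b.alo + b.epsLo) with h1 | h1
    · -- on the left edge: `fLo t ∈ (-δ, fLo (alo + ε)]`
      rw [b.railLo_eq_left h1, pt2_apply_one]
      have hlt : b.fLo b.tstarLo < b.fLo t := b.strictMonoOn_fLo (show b.tstarLo ∈ Iic _ by
        simp only [mem_Iic]; linarith) (show t ∈ Iic _ by simp only [mem_Iic]; linarith) ht.1
      have hle : b.fLo t ≤ b.fLo (b.alo + b.epsLo) := b.strictMonoOn_fLo.monotoneOn
        (show t ∈ Iic _ by simp only [mem_Iic]; linarith)
        (show b.alo + b.epsLo ∈ Iic _ by simp only [mem_Iic]; linarith) h1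
      obtain ⟨-, hf⟩ := b.fLo_eq_heightA (t := b.alo + b.epsLo) ⟨by linarith, by linarith⟩
      rw [b.tstarLo_spec.2] at hlt
      rw [(b.fLo_eq_heightA (t := b.alo + b.epsLo) ⟨by linarith, by linarith⟩).1] at hle
      exact ⟨hlt, by linarith [hf.2]⟩
    rcases lt_or_ge t (b.tlo - b.epsLo) with h2 | h2
    · have := (b.railLo_mem (t := t) ⟨by linarith, by linarith⟩).2
      exact ⟨by linarith [this.1], this.2⟩
    · -- on the right edge: `gLo t ∈ (-δ, gLo (tlo - ε)]`
      rw [b.railLo_eq_right h2, pt2_apply_one]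
      have hw := b.tlo_marksB
      have hlt : b.gLo b.tendLo < b.gLo t := b.strictAntiOn_gLo (show t ∈ Ici _ by
        simp only [mem_Ici]; linarith) (show b.tendLo ∈ Ici _ by simp only [mem_Ici]; linarith) ht.2
      have hle : b.gLo t ≤ b.gLo (b.tlo - b.epsLo) := b.strictAntiOn_gLo.antitoneOn
        (show b.tlo - b.epsLo ∈ Ici _ by simp only [mem_Ici]; linarith)
        (show t ∈ Ici _ by simp only [mem_Ici]; linarith) h2
      have hg := b.gLo_mem (show b.tlo - b.epsLo ≤ b.psiInv (b.thetaB (3 / 20)) by linarith)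
      rw [b.tendLo_spec.2] at hlt
      exact ⟨hlt, by linarith [hg.2]⟩
  refine ⟨?_, hx1⟩
  rw [mem_squareNhd_iff, Fin.forall_fin_two]
  exact ⟨⟨by linarith [hx0.1], by linarith [hx0.2]⟩, ⟨hx1.1, by linarith [hx1.2]⟩⟩

/-- **The upper arc lies in the upper half of the square neighbourhood**: heights in
`(3/5, 1 + δ)`. [folklore] -/
theorem railUp_mem_of_mem_Ioo {t : ℝ} (ht : t ∈ Ioo b.tstarUp b.tendUp) :
    b.railUp t ∈ squareNhd b.δ ∧ b.railUp t 1 ∈ Ioo (3 / 5 : ℝ) (1 + b.δ) := by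
  have hm := b.marks_lt
  have hδ := b.δ_pos
  obtain ⟨hε, hε1, -⟩ := b.epsHi_bounds
  have ho := b.up_order
  have hw := b.thi_marksB
  have hx0 := b.railUp_zero_mem_Icc t
  have hx1 : b.railUp t 1 ∈ Ioo (3 / 5 : ℝ) (1 + b.δ) := by
    rcases le_or_gt t (b.thi + b.epsHi) with h1 | h1
    · -- on the right edge: `gUp t ∈ [gUp (thi + ε), 1 + δ)`
      rw [b.railUp_eq_right h1, pt2_apply_one]
      have hlt : b.gUp t < b.gUp b.tstarUp := b.strictAntiOn_gUp (show b.tstarUp ∈ Iic _ by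
        simp only [mem_Iic]; linarith [b.tstarUp_spec.1]) (show t ∈ Iic _ by simp only [mem_Iic]; linarith) ht.1
      have hge : b.gUp (b.thi + b.epsHi) ≤ b.gUp t := b.strictAntiOn_gUp.antitoneOn
        (show t ∈ Iic _ by simp only [mem_Iic]; linarith)
        (show b.thi + b.epsHi ∈ Iic _ by simp only [mem_Iic]; linarith) h1
      have hg := b.gUp_mem (show b.psiInv (b.thetaB (17 / 20) + 1) ≤ b.thi + b.epsHi by linarith)
      rw [b.tstarUp_spec.2] at hlt
      exact ⟨by linarith [hg.1], hlt⟩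
    rcases lt_or_ge t (b.ahi - b.epsHi) with h2 | h2
    · have := (b.railUp_mem (t := t) ⟨by linarith, by linarith⟩).2
      exact ⟨this.1, by linarith [this.2]⟩
    · -- on the left edge: `fUp t ∈ [fUp (ahi - ε), 1 + δ)`
      rw [b.railUp_eq_left h2, pt2_apply_one]
      have hlt : b.fUp t < b.fUp b.tendUp := b.strictMonoOn_fUp (show t ∈ Ici _ by
        simp only [mem_Ici]; linarith) (show b.tendUp ∈ Ici _ by simp only [mem_Ici]; linarith) ht.2
      have hge : b.fUp (b.ahi - b.epsHi) ≤ b.fUp t := b.strictMonoOn_fUp.monotoneOn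
        (show b.ahi - b.epsHi ∈ Ici _ by simp only [mem_Ici]; linarith)
        (show t ∈ Ici _ by simp only [mem_Ici]; linarith) h2
      obtain ⟨he, hf⟩ := b.fUp_eq_heightA (t := b.ahi - b.epsHi) ⟨by linarith, by linarith⟩
      rw [b.tendUp_spec.2] at hlt
      rw [he] at hge
      exact ⟨by linarith [hf.1], hlt⟩
  refine ⟨?_, hx1⟩
  rw [mem_squareNhd_iff, Fin.forall_fin_two]
  exact ⟨⟨by linarith [hx0.1], by linarith [hx0.2]⟩, ⟨by linarith [hx1.1], hx1.2⟩⟩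

/-- The membership clause of the lower arc. [folklore] -/
theorem railLoArc_mem {u : ℝ} (hu : u ∈ Ioo (0 : ℝ) 1) : b.railLoArc u ∈ squareNhd b.δ ∧ b.railLoArc u 1 < 2⁻¹ := by
  obtain ⟨h1, h2⟩ := b.railLo_mem_of_mem_Ioo (b.rhoLo_mem hu)
  exact ⟨h1, by rw [railLoArc]; linarith [h2.2]⟩

/-- The membership clause of the upper arc. [folklore] -/
theorem railUpArc_mem {u : ℝ} (hu : u ∈ Ioo (0 : ℝ) 1) : b.railUpArc u ∈ squareNhd b.δ ∧ 2⁻¹ < b.railUpArc u 1 := by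
  obtain ⟨h1, h2⟩ := b.railUp_mem_of_mem_Ioo (b.rhoUp_mem hu)
  exact ⟨h1, by rw [railUpArc]; linarith [h2.1]⟩

/-- The image of the lower arc is the image of the arch over its stretch. [folklore] -/
theorem image_railLoArc : b.railLoArc '' Ioo 0 1 = b.railLo '' Ioo b.tstarLo b.tendLo := by
  ext x
  constructor
  · rintro ⟨u, hu, rfl⟩
    exact ⟨_, b.rhoLo_mem hu, rfl⟩
  · rintro ⟨t, ht, rfl⟩
    obtain ⟨u, hu, hut⟩ := b.exists_rhoLo_eq ht
    exact ⟨u, hu, by rw [railLoArc, hut]⟩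

/-- The image of the upper arc is the image of the arch over its stretch. [folklore] -/
theorem image_railUpArc : b.railUpArc '' Ioo 0 1 = b.railUp '' Ioo b.tstarUp b.tendUp := by
  ext x
  constructor
  · rintro ⟨u, hu, rfl⟩
    exact ⟨_, b.rhoUp_mem hu, rfl⟩
  · rintro ⟨t, ht, rfl⟩
    obtain ⟨u, hu, hut⟩ := b.exists_rhoUp_eq ht
    exact ⟨u, hu, by rw [railUpArc, hut]⟩

end BandData

end Literature.Topology.FourManifolds
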